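import Mathlib
import Literature.NumberTheory.LFunctions.KloostermanWeil
import HarnessLib

/-!
# Kloosterman sums to prime-power moduli: elementary reductions — PROVED

Topic `NumberTheory/LFunctions` (exponential sums); third file on the classical Kloosterman sum
`Literature.NumberTheory.LFunctions.kloostermanSum q a b = ∑_{x ∈ (ℤ/qℤ)ˣ} e((a x + b x̄)/q)`
(`KloostermanPrimePower.lean`, `KloostermanWeil.lean`), preparing the reduction of Weil's bound
(2.25) [cite: Iwaniec2002, §2.5 (2.25)] for prime-power moduli to the prime case.  Contents
(all PROVED, all folklore; cf. Iwaniec–Kowalski, *Analytic Number Theory*, §1.5 and §12.3):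

* `kloostermanSum_eq_sum_units` (the sum as a sum over the unit group), `kloostermanSum_comm`
  (`S(a, b; q) = S(b, a; q)`, `x ↦ x̄`), `kloostermanSum_eq_one_mul` (`S(a, b; q) = S(1, ab; q)`
  for a unit `a`), `norm_kloostermanSum_le` (the trivial bound `|S| ≤ q`);
* `kloostermanSum_zero_right` (`S(a, 0; p) = −1` for `a ≢ 0 (mod p)`, a Ramanujan sum);
* `sum_comp_castHom_eq_mul_sum` (fibres of `ℤ/Mℤ → ℤ/nℤ` have `M/n` elements) and
  `kloostermanSum_lift` (**imprimitive sums**: `S(pm, pn; p^{k+1}) = p · S(m, n; p^k)`, `k ≥ 1`);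
* `kloostermanSum_one_stationary` (the stationary-phase formula behind
  `norm_kloostermanSum_one_le`, as a standalone identity) and `kloostermanSum_one_eq_zero`
  (**vanishing**: `S(1, b; p^K) = 0` for `K ≥ 2` and `p ∣ b`).

## References

* H. Iwaniec, E. Kowalski, *Analytic Number Theory*, AMS Colloq. Publ. 53 (2004), §1.5, §12.3.
* H. Iwaniec, *Spectral Methods of Automorphic Forms*, 2nd ed. (2002), §2.5 (`Iwaniec2002`).
-/

noncomputable section

open Finset

namespace Literature.NumberTheory.LFunctions

/-! ### The sum over the unit group; symmetry; scaling; the trivial bound -/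

section General

variable {q : ℕ} [NeZero q]

/-- A sum over `ℤ/qℤ` with the non-units omitted is a sum over the unit group. [folklore] -/
theorem sum_ite_isUnit_eq_sum_units (f : ZMod q → ℂ) :
    (by classical exact ∑ x : ZMod q, if IsUnit x then f x else 0) =
      ∑ u : (ZMod q)ˣ, f (u : ZMod q) := by
  classical
  rw [← Finset.sum_filter]
  symm
  refine Finset.sum_bij (fun (u : (ZMod q)ˣ) _ => (u : ZMod q)) ?_ ?_ ?_ ?_
  · intro u _
    exact Finset.mem_filter.mpr ⟨Finset.mem_univ _, Units.isUnit u⟩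
  · intro u _ v _ huv
    exact Units.ext huv
  · intro x hx
    obtain ⟨u, rfl⟩ := (Finset.mem_filter.mp hx).2
    exact ⟨u, Finset.mem_univ _, rfl⟩
  · intro u _
    rfl

/-- `S(a, b; q) = ∑_{u ∈ (ℤ/qℤ)ˣ} e((a u + b u⁻¹)/q)` with the group inverse. [folklore] -/
theorem kloostermanSum_eq_sum_units (a b : ZMod q) :
    kloostermanSum q a b =
      ∑ u : (ZMod q)ˣ, (ZMod.stdAddChar (a * (u : ZMod q) + b * ((u⁻¹ : (ZMod q)ˣ) : ZMod q)) : ℂ) := by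
  unfold kloostermanSum
  rw [sum_ite_isUnit_eq_sum_units]
  refine Fintype.sum_congr _ _ fun u => ?_
  rw [ZMod.inv_coe_unit]

/-- **Symmetry** `S(a, b; q) = S(b, a; q)` (substitute `x ↦ x̄`). [folklore] -/
theorem kloostermanSum_comm (a b : ZMod q) : kloostermanSum q a b = kloostermanSum q b a := by
  rw [kloostermanSum_eq_sum_units, kloostermanSum_eq_sum_units]
  refine Fintype.sum_equiv (Equiv.inv (ZMod q)ˣ) _ _ fun u => ?_
  simp only [Equiv.inv_apply, inv_inv]
  rw [add_comm]

/-- **Scaling** `S(a, b; q) = S(1, ab; q)` for a unit `a` (substitute `x ↦ ā x`). [folklore] -/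
theorem kloostermanSum_eq_one_mul {a : ZMod q} (ha : IsUnit a) (b : ZMod q) :
    kloostermanSum q a b = kloostermanSum q 1 (a * b) := by
  obtain ⟨ua, rfl⟩ := ha
  rw [kloostermanSum_eq_sum_units, kloostermanSum_eq_sum_units]
  refine Fintype.sum_equiv (Equiv.mulLeft ua) _ _ fun u => ?_
  simp only [Equiv.coe_mulLeft, one_mul, mul_inv_rev, Units.val_mul]
  congr 2
  have h : (ua : ZMod q) * ((ua⁻¹ : (ZMod q)ˣ) : ZMod q) = 1 := Units.mul_inv ua
  linear_combination (-(b * ((u⁻¹ : (ZMod q)ˣ) : ZMod q))) * h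

/-- **The trivial bound** `|S(a, b; q)| ≤ q`. [folklore] -/
theorem norm_kloostermanSum_le (a b : ZMod q) : ‖kloostermanSum q a b‖ ≤ q := by
  classical
  unfold kloostermanSum
  refine (norm_sum_le _ _).trans ?_
  have hle : ∀ x : ZMod q,
      ‖(if IsUnit x then (ZMod.stdAddChar (a * x + b * x⁻¹) : ℂ) else 0)‖ ≤ 1 := by
    intro x
    split_ifs
    · rw [ZMod.stdAddChar_apply, Circle.norm_coe]
    · rw [norm_zero]; exact zero_le_one
  refine (Finset.sum_le_sum fun x _ => hle x).trans ?_
  rw [Finset.sum_const, Finset.card_univ, ZMod.card, nsmul_eq_mul, mul_one]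

end General

/-! ### Prime moduli: the Ramanujan sum `S(a, 0; p) = −1` -/

section Prime

variable {p : ℕ} [hp : Fact p.Prime]

/-- `S(a, 0; p) = ∑_{x ≢ 0} e(ax/p) = −1` for `a ≢ 0 (mod p)`. [folklore] -/
theorem kloostermanSum_zero_right {a : ZMod p} (ha : a ≠ 0) : kloostermanSum p a 0 = -1 := by
  classical
  have hsum : ∑ x : ZMod p, (ZMod.stdAddChar (x * a) : ℂ) = 0 := by
    rw [AddChar.sum_mulShift _ (ZMod.isPrimitive_stdAddChar p), if_neg ha, Nat.cast_zero]
  have hsplit : ∑ x : ZMod p, (ZMod.stdAddChar (x * a) : ℂ) =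
      (ZMod.stdAddChar ((0 : ZMod p) * a) : ℂ) +
        ∑ x ∈ Finset.univ.erase (0 : ZMod p), (ZMod.stdAddChar (x * a) : ℂ) :=
    (Finset.add_sum_erase _ _ (Finset.mem_univ _)).symm
  rw [zero_mul, AddChar.map_zero_eq_one] at hsplit
  have hrest : ∑ x ∈ Finset.univ.erase (0 : ZMod p), (ZMod.stdAddChar (x * a) : ℂ) = -1 := by
    linear_combination hsum - hsplit
  rw [← hrest]
  unfold kloostermanSum
  rw [← Finset.sum_filter]
  refine Finset.sum_congr ?_ fun x _ => ?_
  · ext x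
    simp only [Finset.mem_filter, Finset.mem_univ, true_and, Finset.mem_erase, and_true]
    exact isUnit_iff_ne_zero
  · rw [zero_mul, add_zero, mul_comm]

end Prime

/-! ### Fibres of the reduction map and imprimitive sums -/

/-- **Fibres of `ℤ/Mℤ → ℤ/nℤ`** (`n ∣ M`): `∑_{x mod M} H(x mod n) = (M/n) ∑_{y mod n} H(y)`.
[folklore] -/
theorem sum_comp_castHom_eq_mul_sum {M n : ℕ} [NeZero M] [NeZero n] (h : n ∣ M)
    (H : ZMod n → ℂ) :
    ∑ x : ZMod M, H (ZMod.castHom h (ZMod n) x) = (M / n : ℕ) * ∑ y : ZMod n, H y := by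
  obtain ⟨d, hd⟩ := h
  have hn : 0 < n := Nat.pos_of_ne_zero (NeZero.ne n)
  have hdiv : M / n = d := by rw [hd, Nat.mul_div_cancel_left _ hn]
  rw [sum_zmod_eq_sum_range, sum_zmod_eq_sum_range (fun y : ZMod n => H y), hdiv,
    show Finset.range M = Finset.range (n * d) by rw [hd], sum_range_mul_eq_sum_sum]
  have hterm : ∀ u v : ℕ, H (ZMod.castHom ⟨d, hd⟩ (ZMod n) ((u + n * v : ℕ) : ZMod M)) =
      H ((u : ℕ) : ZMod n) := by
    intro u v
    rw [map_natCast]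
    push_cast
    rw [ZMod.natCast_self, zero_mul, add_zero]
  simp_rw [hterm]
  rw [Finset.sum_comm, Finset.sum_const, Finset.card_range, nsmul_eq_mul]

section PrimePow

variable {p : ℕ} [hp : Fact p.Prime]

/-- `e(p y / p^{k+1}) = e((y mod p^k)/p^k)`. [folklore] -/
theorem stdAddChar_prime_mul (k : ℕ) (y : ZMod (p ^ (k + 1))) :
    (ZMod.stdAddChar ((p : ZMod (p ^ (k + 1))) * y) : ℂ) =
      ZMod.stdAddChar (ZMod.castHom (pow_dvd_pow p (Nat.le_succ k)) (ZMod (p ^ k)) y) := by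
  have hy : y = ((y.val : ℕ) : ZMod (p ^ (k + 1))) := (ZMod.natCast_zmod_val y).symm
  rw [hy, map_natCast, show (p : ZMod (p ^ (k + 1))) * ((y.val : ℕ) : ZMod (p ^ (k + 1))) =
      ((p ^ 1 * y.val : ℕ) : ZMod (p ^ (k + 1))) by push_cast; ring]
  exact stdAddChar_pow_mul_natCast (k := 1) (l := k) (m := k + 1) (by omega) y.val

/-- **Imprimitive Kloosterman sums lift**: for `k ≥ 1` and integers `m, n`,
`S(pm, pn; p^{k+1}) = p · S(m, n; p^k)` (the summand depends only on `x mod p^k`, and each unit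
modulo `p^k` has `p` unit lifts modulo `p^{k+1}`). [folklore] -/
theorem kloostermanSum_lift {k : ℕ} (hk : k ≠ 0) (m n : ℤ) :
    kloostermanSum (p ^ (k + 1)) ((p * m : ℤ) : ZMod (p ^ (k + 1))) ((p * n : ℤ) : ZMod (p ^ (k + 1))) =
      (p : ℂ) * kloostermanSum (p ^ k) (m : ZMod (p ^ k)) (n : ZMod (p ^ k)) := by
  classical
  -- units correspond
  have hunit : ∀ x : ZMod (p ^ (k + 1)), IsUnit x ↔
      IsUnit (ZMod.castHom (pow_dvd_pow p (Nat.le_succ k)) (ZMod (p ^ k)) x) := by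
    intro x
    have hx : x = ((x.val : ℕ) : ZMod (p ^ (k + 1))) := (ZMod.natCast_zmod_val x).symm
    rw [hx, map_natCast, isUnit_natCast_iff_not_dvd (by omega), isUnit_natCast_iff_not_dvd hk]
  -- the summand through the reduction map
  have hterm : ∀ x : ZMod (p ^ (k + 1)),
      (if IsUnit x then (ZMod.stdAddChar (((p * m : ℤ) : ZMod (p ^ (k + 1))) * x +
          ((p * n : ℤ) : ZMod (p ^ (k + 1))) * x⁻¹) : ℂ) else 0) =
        (fun y : ZMod (p ^ k) => if IsUnit y then
          (ZMod.stdAddChar ((m : ZMod (p ^ k)) * y + (n : ZMod (p ^ k)) * y⁻¹) : ℂ) else 0)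
          (ZMod.castHom (pow_dvd_pow p (Nat.le_succ k)) (ZMod (p ^ k)) x) := by
    intro x
    dsimp only
    by_cases hx : IsUnit x
    · rw [if_pos hx, if_pos ((hunit x).mp hx)]
      have e : ((p * m : ℤ) : ZMod (p ^ (k + 1))) * x + ((p * n : ℤ) : ZMod (p ^ (k + 1))) * x⁻¹ =
          (p : ZMod (p ^ (k + 1))) * ((m : ZMod (p ^ (k + 1))) * x + (n : ZMod (p ^ (k + 1))) * x⁻¹) := by
        push_cast; ring
      rw [e, stdAddChar_prime_mul, map_add, map_mul, map_mul, map_intCast, map_intCast,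
        ZMod.castHom_apply, ZMod.castHom_apply,
        ZMod.cast_inv_of_isUnit (pow_dvd_pow p (Nat.le_succ k)) hx]
    · rw [if_neg hx, if_neg (fun h => hx ((hunit x).mpr h))]
  unfold kloostermanSum
  rw [Finset.sum_congr rfl fun x _ => hterm x,
    sum_comp_castHom_eq_mul_sum (pow_dvd_pow p (Nat.le_succ k)) (fun y : ZMod (p ^ k) =>
      if IsUnit y then (ZMod.stdAddChar ((m : ZMod (p ^ k)) * y + (n : ZMod (p ^ k)) * y⁻¹) : ℂ)
      else 0)]
  congr 1
  rw [pow_succ, Nat.mul_div_cancel_left _ (pow_pos hp.out.pos k)]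

/-! ### The stationary-phase formula and the vanishing of `S(1, b; p^K)` for `p ∣ b`, `K ≥ 2` -/

/-- **Stationary phase for `S(1, b; p^m)`** (the identity behind `norm_kloostermanSum_one_le`):
with `m = k + l`, `m ≤ 2k` (and `k ≥ 1` unless `m = 0`), writing `x = u + p^k v`,
`S(1, b; p^m) = ∑_{u < p^k, p ∤ u} e((u + b ū)/p^m) · p^l 𝟙[b ū² ≡ 1 (mod p^l)]`. [folklore] -/
theorem kloostermanSum_one_stationary {k l m : ℕ} (hklm : k + l = m) (hm2 : m ≤ 2 * k)
    (hk0 : m = 0 ∨ k ≠ 0) (b : ZMod (p ^ m)) :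
    kloostermanSum (p ^ m) 1 b = ∑ u ∈ range (p ^ k),
      if IsUnit ((u : ℕ) : ZMod (p ^ m)) then
        (ZMod.stdAddChar (((u : ℕ) : ZMod (p ^ m)) + b * ((u : ℕ) : ZMod (p ^ m))⁻¹) : ℂ) *
          (if ZMod.castHom (pow_dvd_pow p (hklm ▸ Nat.le_add_left l k)) (ZMod (p ^ l))
              (1 - b * ((u : ℕ) : ZMod (p ^ m))⁻¹ ^ 2) = 0
            then ((p ^ l : ℕ) : ℂ) else 0)
      else 0 := by
  classical
  have hpm : range (p ^ m) = range (p ^ k * p ^ l) := by rw [← pow_add, hklm]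
  rw [kloostermanSum, sum_zmod_eq_sum_range, hpm, sum_range_mul_eq_sum_sum]
  refine Finset.sum_congr rfl fun u _ ↦ ?_
  by_cases hu : IsUnit ((u : ℕ) : ZMod (p ^ m))
  · rw [if_pos hu, ← sum_range_stdAddChar_pow_mul hklm, Finset.mul_sum]
    refine Finset.sum_congr rfl fun v _ ↦ ?_
    rw [if_pos ((isUnit_natCast_add_pow_mul_iff hk0 u v).mpr hu),
      stdAddChar_kloosterman_term hm2 b u v hu]
  · rw [if_neg hu]
    refine Finset.sum_eq_zero fun v _ ↦ ?_
    rw [if_neg (mt (isUnit_natCast_add_pow_mul_iff hk0 u v).mp hu)]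

/-- A non-unit of `ℤ/p^Kℤ` reduces to `0` modulo `p`. [folklore] -/
theorem castHom_eq_zero_of_not_isUnit {K : ℕ} (hK : K ≠ 0) {b : ZMod (p ^ K)} (hb : ¬ IsUnit b)
    (h1 : p ^ 1 ∣ p ^ K) : ZMod.castHom h1 (ZMod (p ^ 1)) b = 0 := by
  have hb' : b = ((b.val : ℕ) : ZMod (p ^ K)) := (ZMod.natCast_zmod_val b).symm
  rw [hb', isUnit_natCast_iff_not_dvd hK, not_not] at hb
  rw [hb', map_natCast, ZMod.natCast_eq_zero_iff, pow_one]
  exact hb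

/-- **Vanishing**: `S(1, b; p^K) = 0` for `K ≥ 2` and `p ∣ b` (with `x = u + p^{K−1} v` the sum
over `v` is `∑_{v mod p} e(v(1 − b ū²)/p) = ∑_v e(v/p) = 0`). [folklore] -/
theorem kloostermanSum_one_eq_zero {K : ℕ} (hK : 2 ≤ K) {b : ZMod (p ^ K)} (hb : ¬ IsUnit b) :
    kloostermanSum (p ^ K) 1 b = 0 := by
  classical
  have hklm : (K - 1) + 1 = K := by omega
  rw [kloostermanSum_one_stationary hklm (by omega) (Or.inr (by omega)) b]
  refine Finset.sum_eq_zero fun u _ => ?_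
  split_ifs with hu h0
  · exfalso
    have hb0 := castHom_eq_zero_of_not_isUnit (by omega) hb
      (pow_dvd_pow p (hklm ▸ Nat.le_add_left 1 (K - 1)))
    rw [map_sub, map_one, map_mul, hb0, zero_mul, sub_zero] at h0
    haveI : Fact (1 < p ^ 1) := ⟨by rw [pow_one]; exact hp.out.one_lt⟩
    exact one_ne_zero h0
  · rw [mul_zero]
  · rfl

end PrimePow

end Literature.NumberTheory.LFunctions

end
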